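import Summits.ResolutionOfSingularities.ResolutionOfSingularities.Theorems.FrobeniusClosingSteerSigmaTopLegality
import Summits.ResolutionOfSingularities.ResolutionOfSingularities.Theorems.FrobeniusClosingSteerRadicandChainNonIsolated
import Literature.AlgebraicGeometry.Resolution.AdicCompletionRegular
import Literature.AlgebraicGeometry.Resolution.RegularLocalHeights
import HarnessLib

/-!
# Crux `Steer` (stmt-ResolutionOfSingularities-16345), chain W4.1: σ_top LEGALITY BRICKS for the F-B / F-A1 side,
# part 3 — (L6) «an ODD fully-stripped exceptional divisor through the centre makes the stage NON-ISOLATED»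
# and (F) the SURFACE FORK (height-2 singular primes are top components when no divisor is singular)
# (res-L0-w41-tri-1 PREREG-FB v1.4 LEMMA D·S5; res-L0-w41-plan-1 RULING 76; Theses-free research support)

OURS (campaign `res-hironaka`, rung L ★L-G4, slot W4.1; statements about the route's own objects; they replace the
role of no printed item and are NOT statements of the manuscript under review [claim: Hironaka2017, status:
under-review]; AI review is weaker than expert review). Seat res-D-pv-004 (AS res-L0-w41-stub-10). Parts 1–2:
`FrobeniusClosingSteerSigmaTopLegality.lean` (words, (L1), (L5)) and `FrobeniusClosingSteerSigmaTopLegalityForest.lean`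
((L2)–(L4)). The words `RadicandRing`, `IsSingPrime` are part 1's (VERBATIM `Steer_r31.lean` 727d9e199382098a);
`HasIsolatedSingularity` is re-declared here VERBATIM (r31 l.1378).

## (L6) tri-1's LEMMA D·S5 (char 2, any base dimension `c ≥ 3`)

Let `R ⊆ K` be a REGULAR LOCAL member (`K` a field of characteristic `2`), `f ∈ R` the radicand of the torsor
`T² = f`, and suppose `f = h² + x·G` with `x ∈ 𝔪` (an exceptional divisor `E = V(x)` through the centre modulo which
`f` is a square: an ODD divisor, fully stripped). Then:

* (L6a) `mem_maximalIdeal_of_isSingPrime_maximalIdeal`: if `x ∉ 𝔪²` and the torsor is SINGULAR at the closed point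
  (`IsSingPrime R 2 f 𝔪` — the run has not ended), then `G ∈ 𝔪` («else `t² = h² + x·unit` is regular at the centre»).
* (L6b/c) `sub_sq_mem_sq_of_mem`, `isSingPrime_of_mem`: `f − h² = x·G ∈ Q²` for every ideal `Q ∋ x, G`; hence every
  PRIME `Q ⊇ (x, G)` is a singular prime of `T² = f` (res-type-082's converse criterion
  `AutoPermissible.singular_atPrime_of_sub_pow_mem_sq`).
* (L6d) `exists_mem_minimalPrimes_span_pair`, `height_le_two_of_mem_minimalPrimes_span_pair`,
  `ne_maximalIdeal_of_mem_minimalPrimes_span_pair`, `height_eq_two_of_mem_minimalPrimes_span_pair`: with `x, G ∈ 𝔪`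
  minimal primes `Q` over `(x, G)` exist, have height `≤ 2` (Krull's height theorem, Mathlib), are `≠ 𝔪` as soon as
  `dim R = c ≥ 3` (the chain's currency `ringKrullDim R = c`), and have height EXACTLY `2` when `(x)` is a prime not containing `G`
  (`isPrime_span_singleton_of_not_mem_sq`: a regular parameter `x ∈ 𝔪 ∖ 𝔪²` generates a prime; `height_eq_two_of_not_mem_sq`).
* (L6e) **`not_hasIsolatedSingularity_of_oddDivisor`**: with `x, G ∈ 𝔪` and `ringKrullDim R = c`, `3 ≤ c`, the radicand ring
  `R[T]/(T² − f)` does NOT have an isolated singularity — by res-type-096's non-isolatedness criterion (B1)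
  `RadicandChain.exists_nonmaximal_not_isRegularLocalRing_of_sub_pow_mem_sq` at a minimal `Q ≠ 𝔪` over `(x, G)`.
* (L6f) `oddDivisor_anatomy`: the package from «`f = h² + xG`, `x ∈ 𝔪 ∖ 𝔪²`, singular at `𝔪`, `dim R = c ≥ 3`».

## (F) Top singular components from heights, and the SURFACE FORK in words (§7; «(F)» = fork — NOT res-L0-w41-plan-1's (L7) «enough derivations», which is a separate file)

* (Fa/b) `two_le_height_of_isSingPrime`, `isTopSingComponent_of_height_two` (any `p`): if the torsor `T^p = f` has
  NO singular prime of height `0` (generic torsor regular, `f ∉ K^p` — RunHygiene's `hirr`) and NO singular prime of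
  height `1` (no singular DIVISOR — the post-strip situation, supplied by the consumer from N4 /
  `false_of_normalAt_of_carrier_off_exceptional`), then every singular prime has height `≥ 2`, and a singular prime of
  height EXACTLY `2` is a TOP singular component (minimal among singular primes by height; of maximal dimension among
  them by the dimension formula `ht Q + dim R⧸Q = dim R` of a regular local ring, tree
  `height_add_ringKrullDim_quotient`).
* (Fc) `isPermissibleCentre_two_iff_of_height_two`: with part 1's (L1c), such a `Q ≠ 𝔪` is σ_top-permissible iff
  `R ⧸ Q` is regular.
* (Fd) **`oddDivisor_fork`** = D·S5's fork: every minimal prime `Q` over `(x, G)` is a top singular component, and it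
  is permissible iff `R ⧸ Q` is regular (σ_top takes the height-2 centre), else a POINT step at a non-isolated stage.

The hypotheses «no singular prime of height 0 / 1» are the run context and are NOT discharged here. No Theses file is
imported; nothing here is a route item or a registration. [cite: Matsumura1987, Thm. 14.2] [cite: Matsumura1987,
Thm. 19.3] [cite: Matsumura1987, §5 p. 31]
-/

noncomputable section

-- `Summit.<S>.<S>.…` duplicates the summit name by design (single-problem summit).
set_option linter.dupNamespace false

open Polynomial IsLocalRing

namespace Summit.ResolutionOfSingularities.ResolutionOfSingularities.Theorems.SwitchingDichotomy.SigmaTopLegality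

open Literature.AlgebraicGeometry.Resolution

/-! ## §0 One more word (VERBATIM `Steer_r31.lean` 727d9e199382098a l.1378; only the namespace differs) -/

/-- Isolated singularity (for a local ring: away from the closed point): every NON-maximal prime localises to a
regular local ring. (idea-1, verbatim; VERBATIM r31 l.1378) [folklore] -/
def HasIsolatedSingularity (R : Type) [CommRing R] : Prop :=
  ∀ (P : Ideal R) [P.IsPrime], (∃ Q : Ideal R, Q.IsPrime ∧ P < Q) → IsRegularLocalRing (Localization.AtPrime P)

variable {K : Type} [Field K]

/-! ## §6 (L6) Odd fully-stripped divisor through the centre ⇒ non-isolated stage -/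

section Ring

variable {A : Type*} [CommRing A]

/-- **(L6b)** If `f = h² + x·G` and `x, G ∈ Q` then `f − h² ∈ Q²`. [folklore] -/
theorem sub_sq_mem_sq_of_mem {f h x G : A} (hf : f = h ^ 2 + x * G) {Q : Ideal A} (hx : x ∈ Q)
    (hG : G ∈ Q) : f - h ^ 2 ∈ Q ^ 2 := by
  rw [hf, add_sub_cancel_left, pow_two]
  exact Ideal.mul_mem_mul hx hG

end Ring

section OddDivisor

variable [CharP K 2]

/-- **(L6a) `G ∈ 𝔪` at a singular stage** (res-L0-w41-tri-1 D·S5: «else `t² = h² + x·unit` is REGULAR at the centre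
— the run would have ended»). For a regular local member `R` of characteristic `2`, `f = h² + x·G` with
`x ∈ 𝔪 ∖ 𝔪²`: if the torsor `T² = f` is singular at the closed point (`IsSingPrime R 2 f 𝔪`), then `G ∈ 𝔪`. Proof:
singular at `𝔪` gives `g` with `f − g² ∈ 𝔪²` (res-type-082's criterion at the closed point); in characteristic `2`,
`f − g² = (h − g)² + x·G`; if `G` were a unit, either `h − g ∈ 𝔪` and then `x·G ∈ 𝔪²` forces `x ∈ 𝔪²`, or `h − g` is
a unit and then `(h − g)² = (f − g²) − x·G ∈ 𝔪` is absurd. [cite: Matsumura1987, Thm. 14.2] -/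
theorem mem_maximalIdeal_of_isSingPrime_maximalIdeal (R : Subring K) [IsRegularLocalRing R] (f h x G : R)
    (hf : f = h ^ 2 + x * G) (hx : x ∈ maximalIdeal R) (hx2 : x ∉ maximalIdeal R ^ 2)
    (hsing : IsSingPrime R 2 f (maximalIdeal R)) : G ∈ maximalIdeal R := by
  by_contra hGu
  have hGunit : IsUnit G := of_not_not fun h' => hGu ((IsLocalRing.mem_maximalIdeal G).mpr h')
  obtain ⟨g, hg⟩ :=
    (RadicandSingular.not_isRegularLocalRing_adjoinRoot_atMaximalIdeal_iff (S := R) 2 f).mp hsing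
  -- `f − g² = (h − g)² + x G` in characteristic 2
  have hsq : (h - g) ^ 2 = h ^ 2 - g ^ 2 := sub_pow_char h g
  have hdec : f - g ^ 2 = (h - g) ^ 2 + x * G := by rw [hsq, hf]; ring
  by_cases hhg : h - g ∈ maximalIdeal R
  · -- then `x G ∈ 𝔪²`, so `x ∈ 𝔪²`
    have hxG : x * G ∈ maximalIdeal R ^ 2 := by
      have : x * G = (f - g ^ 2) - (h - g) ^ 2 := by rw [hdec]; ring
      rw [this]
      exact Ideal.sub_mem _ hg (Ideal.pow_mem_pow hhg 2)
    obtain ⟨u, hu⟩ := hGunit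
    apply hx2
    have : x = x * G * ↑u⁻¹ := by rw [← hu, mul_assoc, Units.mul_inv, mul_one]
    rw [this]
    exact Ideal.mul_mem_right _ _ hxG
  · -- then `(h − g)²` is a unit lying in `𝔪`: absurd
    have hunit : IsUnit (h - g) := of_not_not fun h' => hhg ((IsLocalRing.mem_maximalIdeal _).mpr h')
    have hmem : (h - g) ^ 2 ∈ maximalIdeal R := by
      have : (h - g) ^ 2 = (f - g ^ 2) - x * G := by rw [hdec]; ring
      rw [this]
      exact Ideal.sub_mem _ (Ideal.pow_le_self two_ne_zero hg) (Ideal.mul_mem_right _ _ hx)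
    exact (IsLocalRing.mem_maximalIdeal _).mp hmem (hunit.pow 2)

/-- **(L6c)** Every PRIME `Q ∋ x, G` is a SINGULAR PRIME of `T² = f` when `f = h² + x·G` (on a regular local member of
characteristic `2`): `f − h² ∈ Q²` and res-type-082's converse criterion. [cite: Matsumura1987, Thm. 14.2] -/
theorem isSingPrime_of_mem (R : Subring K) [IsRegularLocalRing R] (f h x G : R) (hf : f = h ^ 2 + x * G)
    (Q : Ideal R) [Q.IsPrime] (hx : x ∈ Q) (hG : G ∈ Q) : IsSingPrime R 2 f Q :=
  AutoPermissible.singular_atPrime_of_sub_pow_mem_sq K 2 R f Q (sub_sq_mem_sq_of_mem hf hx hG)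

omit [CharP K 2] in
/-- **(L6d, existence)** If `x, G ∈ 𝔪` there is a minimal prime over `(x, G)` (and every prime containing `x, G`
contains one). [folklore] -/
theorem exists_mem_minimalPrimes_span_pair (R : Subring K) [IsLocalRing R] (x G : R)
    (hx : x ∈ maximalIdeal R) (hG : G ∈ maximalIdeal R) :
    ∃ Q ∈ (Ideal.span ({x, G} : Set R)).minimalPrimes, Q ≤ maximalIdeal R :=
  Ideal.exists_minimalPrimes_le
    ((Ideal.span_le (I := maximalIdeal R)).mpr (by
      rintro y (rfl | rfl)
      · exact hx
      · exact hG))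

omit [CharP K 2] in
/-- **(L6d, Krull)** A minimal prime over `(x, G)` has height at most `2` (Krull's height theorem, Mathlib
`Ideal.height_le_card_of_mem_minimalPrimes_span`; `R` Noetherian). [folklore] -/
theorem height_le_two_of_mem_minimalPrimes_span_pair (R : Subring K) [IsNoetherianRing R] (x G : R)
    {Q : Ideal R} (hQ : Q ∈ (Ideal.span ({x, G} : Set R)).minimalPrimes) : Q.height ≤ 2 := by
  have h := Ideal.height_le_card_of_mem_minimalPrimes_span (Set.toFinite _) hQ
  refine h.trans ?_
  have : ({x, G} : Set R).ncard ≤ 2 := by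
    refine (Set.ncard_insert_le x {G}).trans ?_
    rw [Set.ncard_singleton]
  exact_mod_cast this

omit [CharP K 2] in
/-- **(L6d, away from the closed point)** In base dimension `≥ 3` a minimal prime over `(x, G)` is NOT the maximal
ideal (its height is `≤ 2 < 3 ≤ dim R = height 𝔪`). [folklore] -/
theorem ne_maximalIdeal_of_mem_minimalPrimes_span_pair (R : Subring K) [IsLocalRing R] [IsNoetherianRing R]
    (x G : R) {Q : Ideal R} (hQ : Q ∈ (Ideal.span ({x, G} : Set R)).minimalPrimes)
    {c : ℕ} (hc : 3 ≤ c) (hdim : ringKrullDim R = c) : Q ≠ maximalIdeal R := by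
  intro hQm
  have h2 := height_le_two_of_mem_minimalPrimes_span_pair R x G hQ
  rw [hQm] at h2
  have hm : ((maximalIdeal R).height : WithBot ℕ∞) = ((c : ℕ∞) : WithBot ℕ∞) := by
    rw [IsLocalRing.maximalIdeal_height_eq_ringKrullDim, hdim]; rfl
  have hm' : (maximalIdeal R).height = (c : ℕ∞) := WithBot.coe_injective hm
  rw [hm'] at h2
  have : c ≤ 2 := by exact_mod_cast h2
  omega

omit [CharP K 2] in
/-- **(L6d, exact height)** If moreover `(x)` is a PRIME ideal (e.g. `x` a regular parameter), `x ≠ 0` and `G ∉ (x)`,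
then a minimal prime `Q` over `(x, G)` has height EXACTLY `2`: the chain `0 < (x) < Q`. [folklore] -/
theorem height_eq_two_of_mem_minimalPrimes_span_pair (R : Subring K) [IsNoetherianRing R] (x G : R)
    (hx0 : x ≠ 0) (hxp : (Ideal.span ({x} : Set R)).IsPrime) (hGx : G ∉ Ideal.span ({x} : Set R))
    {Q : Ideal R} (hQ : Q ∈ (Ideal.span ({x, G} : Set R)).minimalPrimes) : Q.height = 2 := by
  haveI := hQ.1.1
  refine le_antisymm (height_le_two_of_mem_minimalPrimes_span_pair R x G hQ) ?_
  have hle : Ideal.span ({x, G} : Set R) ≤ Q := hQ.1.2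
  have hlt : Ideal.span ({x} : Set R) < Q := by
    refine lt_of_le_of_ne (Ideal.span_mono (Set.singleton_subset_iff.mpr (by simp)) |>.trans hle) ?_
    intro h
    exact hGx (h ▸ hle (Ideal.subset_span (by simp)))
  have h1 : 1 ≤ (Ideal.span ({x} : Set R)).height :=
    Ideal.one_le_height_span_singleton_of_mem_nonZeroDivisors (mem_nonZeroDivisors_of_ne_zero hx0)
  have h2 := Ideal.height_add_one_le_of_lt_of_isPrime hlt
  calc (2 : ℕ∞) = 1 + 1 := by norm_num
    _ ≤ (Ideal.span ({x} : Set R)).height + 1 := add_le_add h1 le_rfl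
    _ ≤ Q.height := h2

omit [CharP K 2] in
/-- **(L6d′)** A regular parameter generates a prime: for a regular local member `R` and `x ∈ 𝔪 ∖ 𝔪²`, the ideal
`(x)` is prime (`R ⧸ (x)` is a regular local ring, Matsumura 14.2, hence a domain). [cite: Matsumura1987, Thm. 14.2] -/
theorem isPrime_span_singleton_of_not_mem_sq (R : Subring K) [IsRegularLocalRing R] {x : R}
    (hx : x ∈ maximalIdeal R) (hx2 : x ∉ maximalIdeal R ^ 2) : (Ideal.span ({x} : Set R)).IsPrime := by
  haveI := (IsRegularLocalRing.quotient_span_singleton hx hx2).1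
  haveI : IsDomain (R ⧸ Ideal.span ({x} : Set R)) := isDomain_of_isRegularLocalRing _
  exact (Ideal.Quotient.isDomain_iff_prime _).mp ‹_›

omit [CharP K 2] in
/-- **(L6d, exact height, run currency)**: for a regular local member `R`, a regular parameter `x ∈ 𝔪 ∖ 𝔪²` and
`G ∉ (x)` (the odd divisor is FULLY stripped: `f − h² = x·G ∉ (x²)`), every minimal prime over `(x, G)` has height
exactly `2`. [cite: Matsumura1987, Thm. 14.2] -/
theorem height_eq_two_of_not_mem_sq (R : Subring K) [IsRegularLocalRing R] {x G : R}
    (hx : x ∈ maximalIdeal R) (hx2 : x ∉ maximalIdeal R ^ 2) (hGx : G ∉ Ideal.span ({x} : Set R))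
    {Q : Ideal R} (hQ : Q ∈ (Ideal.span ({x, G} : Set R)).minimalPrimes) : Q.height = 2 :=
  height_eq_two_of_mem_minimalPrimes_span_pair R x G (fun h0 => hx2 (h0 ▸ Ideal.zero_mem _))
    (isPrime_span_singleton_of_not_mem_sq R hx hx2) hGx hQ

/-- **(L6e) = res-L0-w41-tri-1 D·S5, the non-isolatedness**: on a regular local member `R` of characteristic `2` and
dimension `≥ 3`, if `f = h² + x·G` with `x, G ∈ 𝔪`, then the radicand ring `R[T]/(T² − f)` does NOT have an isolated
singularity (`dim R = c ≥ 3`): a minimal prime `Q` over `(x, G)` is a non-maximal prime with `f − h² ∈ Q²`, and res-type-096's criterion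
(B1) `RadicandChain.exists_nonmaximal_not_isRegularLocalRing_of_sub_pow_mem_sq` produces a non-maximal prime of the
radicand ring with a non-regular localisation. [cite: Matsumura1987, Thm. 14.2] -/
theorem not_hasIsolatedSingularity_of_oddDivisor (R : Subring K) [IsRegularLocalRing R] (f h x G : R)
    (hf : f = h ^ 2 + x * G) (hx : x ∈ maximalIdeal R) (hG : G ∈ maximalIdeal R)
    {c : ℕ} (hc : 3 ≤ c) (hdim : ringKrullDim R = c) : ¬ HasIsolatedSingularity (RadicandRing R 2 f) := by
  intro hiso
  obtain ⟨Q, hQ, -⟩ := exists_mem_minimalPrimes_span_pair R x G hx hG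
  haveI : Q.IsPrime := hQ.1.1
  have hne : Q ≠ maximalIdeal R := ne_maximalIdeal_of_mem_minimalPrimes_span_pair R x G hQ hc hdim
  have hnotmax : ¬ Q.IsMaximal := fun hm => hne (IsLocalRing.eq_maximalIdeal hm)
  have hfQ : f - h ^ 2 ∈ Q ^ 2 :=
    sub_sq_mem_sq_of_mem hf (hQ.1.2 (Ideal.subset_span (by simp))) (hQ.1.2 (Ideal.subset_span (by simp)))
  haveI : IsRegularRing R := isRegularRing_of_isRegularLocalRing R
  obtain ⟨P', hP', hlt, hreg⟩ :=
    RadicandChain.exists_nonmaximal_not_isRegularLocalRing_of_sub_pow_mem_sq (S := R) 2 f h Q hnotmax hfQ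
  exact hreg (hiso P' hlt)

/-- **(L6f) D·S5 packaged** (res-L0-w41-tri-1 PREREG-FB v1.4; res-L0-w41-plan-1 RULING 76): on a regular local member
`R` of characteristic `2` and dimension `≥ 3`, an ODD fully-stripped exceptional divisor `E = V(x)` through the centre
(`f = h² + x·G`, `x ∈ 𝔪 ∖ 𝔪²`) at a SINGULAR stage (`IsSingPrime R 2 f 𝔪`) forces: `G ∈ 𝔪`; the stage is NOT
isolated; and every minimal prime `Q` over `(x, G)` is a singular prime of `T² = f`, `≠ 𝔪`, of height `≤ 2`,
containing `f − h²` (indeed `f − h² ∈ Q²`). [cite: Matsumura1987, Thm. 14.2] -/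
theorem oddDivisor_anatomy (R : Subring K) [IsRegularLocalRing R] (f h x G : R) (hf : f = h ^ 2 + x * G)
    (hx : x ∈ maximalIdeal R) (hx2 : x ∉ maximalIdeal R ^ 2) (hsing : IsSingPrime R 2 f (maximalIdeal R))
    {c : ℕ} (hc : 3 ≤ c) (hdim : ringKrullDim R = c) :
    G ∈ maximalIdeal R ∧ ¬ HasIsolatedSingularity (RadicandRing R 2 f) ∧
      (∃ Q, Q ∈ (Ideal.span ({x, G} : Set R)).minimalPrimes) ∧
      ∀ Q (hQ : Q ∈ (Ideal.span ({x, G} : Set R)).minimalPrimes),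
        @IsSingPrime K _ R 2 f Q hQ.1.1 ∧ Q ≠ maximalIdeal R ∧ Q.height ≤ 2 ∧ f - h ^ 2 ∈ Q ^ 2 := by
  have hG := mem_maximalIdeal_of_isSingPrime_maximalIdeal R f h x G hf hx hx2 hsing
  obtain ⟨Q₀, hQ₀, -⟩ := exists_mem_minimalPrimes_span_pair R x G hx hG
  refine ⟨hG, not_hasIsolatedSingularity_of_oddDivisor R f h x G hf hx hG hc hdim, ⟨Q₀, hQ₀⟩, fun Q hQ => ?_⟩
  haveI : Q.IsPrime := hQ.1.1
  have hxQ : x ∈ Q := hQ.1.2 (Ideal.subset_span (by simp))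
  have hGQ : G ∈ Q := hQ.1.2 (Ideal.subset_span (by simp))
  exact ⟨isSingPrime_of_mem R f h x G hf Q hxQ hGQ, ne_maximalIdeal_of_mem_minimalPrimes_span_pair R x G hQ hc hdim,
    height_le_two_of_mem_minimalPrimes_span_pair R x G hQ, sub_sq_mem_sq_of_mem hf hxQ hGQ⟩

end OddDivisor

/-! ## §7 (F) Top singular components from heights; the D·S5 fork -/

section TopComponent

variable (p : ℕ)

/-- **(Fa)** If no prime of height `0` and no prime of height `1` is a singular prime of `T^p = f`, then every
singular prime has height `≥ 2`. [folklore] -/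
theorem two_le_height_of_isSingPrime (R : Subring K) (f : R)
    (h0 : ∀ (P : Ideal R) [P.IsPrime], P.height = 0 → ¬ IsSingPrime R p f P)
    (h1 : ∀ (P : Ideal R) [P.IsPrime], P.height = 1 → ¬ IsSingPrime R p f P)
    (Q : Ideal R) [Q.IsPrime] (hQ : IsSingPrime R p f Q) : 2 ≤ Q.height := by
  have hne0 : Q.height ≠ 0 := fun h => h0 Q h hQ
  have hne1 : Q.height ≠ 1 := fun h => h1 Q h hQ
  have hge1 : 1 ≤ Q.height := Order.one_le_iff_ne_zero.mpr hne0
  have hgt1 : 1 < Q.height := lt_of_le_of_ne hge1 (Ne.symm hne1)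
  have := Order.add_one_le_of_lt hgt1
  rwa [one_add_one_eq_two] at this

/-- **(Fb) = the words-level TOP-COMPONENT half of the D·S5 fork.** On a regular local member `R ⊆ K`: if the torsor
`T^p = f` has no singular prime of height `0` or `1` (generic torsor regular, no singular divisor), then a singular
prime `Q` of height EXACTLY `2` is a TOP singular component (`IsTopSingComponent R p f Q`): minimal among singular
primes (a singular `Q' < Q` would have height `< 2`) and of maximal dimension among the minimal singular primes
(`dim R ⧸ Q' = dim R − ht Q' ≤ dim R − 2 = dim R ⧸ Q`, dimension formula of a regular local ring).
[cite: Matsumura1987, §5 p. 31] -/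
theorem isTopSingComponent_of_height_two (R : Subring K) [IsRegularLocalRing R] (f : R)
    (h0 : ∀ (P : Ideal R) [P.IsPrime], P.height = 0 → ¬ IsSingPrime R p f P)
    (h1 : ∀ (P : Ideal R) [P.IsPrime], P.height = 1 → ¬ IsSingPrime R p f P)
    (Q : Ideal R) [Q.IsPrime] (hsing : IsSingPrime R p f Q) (hQ2 : Q.height = 2) :
    IsTopSingComponent R p f Q := by
  refine ⟨‹_›, hsing, fun Q' _ hQ' hle => ?_, fun Q' _ hQ' _ => ?_⟩
  · -- minimality among singular primes
    by_contra hne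
    have hlt : Q'.height < Q.height := Ideal.height_strict_mono_of_isPrime (lt_of_le_of_ne hle hne)
    have h2 := two_le_height_of_isSingPrime p R f h0 h1 Q' hQ'
    rw [hQ2] at hlt
    exact absurd (lt_of_le_of_lt h2 hlt) (lt_irrefl _)
  · -- maximal dimension among the (minimal) singular primes
    have h2' := two_le_height_of_isSingPrime p R f h0 h1 Q' hQ'
    obtain ⟨c, hc⟩ := exists_nat_cast_eq_ringKrullDim (R := R)
    obtain ⟨m', hm'⟩ := ENat.ne_top_iff_exists.mp (Q'.height_ne_top (Ideal.IsPrime.ne_top ‹_›))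
    haveI : Nontrivial (R ⧸ Q) := Ideal.Quotient.nontrivial_iff.mpr (Ideal.IsPrime.ne_top ‹_›)
    haveI : Nontrivial (R ⧸ Q') := Ideal.Quotient.nontrivial_iff.mpr (Ideal.IsPrime.ne_top ‹_›)
    haveI : IsLocalRing (R ⧸ Q) := .of_surjective' _ Ideal.Quotient.mk_surjective
    haveI : IsLocalRing (R ⧸ Q') := .of_surjective' _ Ideal.Quotient.mk_surjective
    obtain ⟨n, hn⟩ := exists_nat_cast_eq_ringKrullDim (R := R ⧸ Q)
    obtain ⟨n', hn'⟩ := exists_nat_cast_eq_ringKrullDim (R := R ⧸ Q')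
    have eQ := height_add_ringKrullDim_quotient (S := R) Q
    have eQ' := height_add_ringKrullDim_quotient (S := R) Q'
    have hQ2' : Q.height = ((2 : ℕ) : ℕ∞) := by rw [hQ2]; rfl
    rw [hQ2', hn, hc] at eQ
    rw [← hm', hn', hc] at eQ'
    rw [← hm'] at h2'
    have e1 : 2 + n = c := by exact_mod_cast eQ
    have e2 : m' + n' = c := by exact_mod_cast eQ'
    have e3 : 2 ≤ m' := by exact_mod_cast h2'
    rw [hn, hn']
    have : n' ≤ n := by omega
    exact_mod_cast this

/-- **(Fc) the fork in words at `p = 2`.** On a regular local member `R ⊆ K` of characteristic `2` with no singular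
prime of height `0` or `1` for `T² = f`, a singular prime `Q ≠ 𝔪` of height `2` is σ_top-PERMISSIBLE iff `R ⧸ Q` is
regular (part 1's `isPermissibleCentre_two_iff` + (Fb)). [cite: Matsumura1987, Thm. 14.2] -/
theorem isPermissibleCentre_two_iff_of_height_two [CharP K 2] (R : Subring K) [IsRegularLocalRing R] (f : R)
    (h0 : ∀ (P : Ideal R) [P.IsPrime], P.height = 0 → ¬ IsSingPrime R 2 f P)
    (h1 : ∀ (P : Ideal R) [P.IsPrime], P.height = 1 → ¬ IsSingPrime R 2 f P)
    (Q : Ideal R) [Q.IsPrime] (hsing : IsSingPrime R 2 f Q) (hQ2 : Q.height = 2)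
    (hQm : Q ≠ maximalIdeal R) :
    IsPermissibleCentre R 2 f Q ↔ IsRegularLocalRing (R ⧸ Q) := by
  rw [isPermissibleCentre_two_iff R f Q]
  exact ⟨fun ⟨_, _, h⟩ => h,
    fun h => ⟨hQm, isTopSingComponent_of_height_two 2 R f h0 h1 Q hsing hQ2, h⟩⟩

end TopComponent

section Fork

variable [CharP K 2]


/-- **(Fd) THE D·S5 SURFACE FORK in words** (res-L0-w41-tri-1 PREREG-FB v1.4; res-L0-w41-plan-1 RULING 76): on a
regular local member `R` of characteristic `2` and dimension `c ≥ 3`, with an odd fully-stripped divisor through the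
centre (`f = h² + x·G`, `x ∈ 𝔪 ∖ 𝔪²`, `G ∉ (x)`; `G ∈ 𝔪` is then forced at a singular stage, §6) and no singular prime of height `0` or `1` (generic torsor
regular, no singular divisor — the post-strip situation), every minimal prime `Q` over `(x, G)` is a TOP singular
component of `T² = f`, and it is σ_top-PERMISSIBLE iff `R ⧸ Q` is regular: σ_top takes the height-2 centre `Q` when
some such quotient is regular, and otherwise a POINT step at a NON-isolated stage (§6). [cite: Matsumura1987, Thm. 14.2] -/
theorem oddDivisor_fork (R : Subring K) [IsRegularLocalRing R] (f h x G : R) (hf : f = h ^ 2 + x * G)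
    (hx : x ∈ maximalIdeal R) (hx2 : x ∉ maximalIdeal R ^ 2) (hGx : G ∉ Ideal.span ({x} : Set R))
    (h0 : ∀ (P : Ideal R) [P.IsPrime], P.height = 0 → ¬ IsSingPrime R 2 f P)
    (h1 : ∀ (P : Ideal R) [P.IsPrime], P.height = 1 → ¬ IsSingPrime R 2 f P)
    {c : ℕ} (hc : 3 ≤ c) (hdim : ringKrullDim R = c)
    {Q : Ideal R} (hQ : Q ∈ (Ideal.span ({x, G} : Set R)).minimalPrimes) :
    IsTopSingComponent R 2 f Q ∧ (IsPermissibleCentre R 2 f Q ↔ IsRegularLocalRing (R ⧸ Q)) := by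
  haveI : Q.IsPrime := hQ.1.1
  have hsing : IsSingPrime R 2 f Q :=
    isSingPrime_of_mem R f h x G hf Q (hQ.1.2 (Ideal.subset_span (by simp))) (hQ.1.2 (Ideal.subset_span (by simp)))
  have hQ2 : Q.height = 2 := height_eq_two_of_not_mem_sq R hx hx2 hGx hQ
  have hQm : Q ≠ maximalIdeal R := ne_maximalIdeal_of_mem_minimalPrimes_span_pair R x G hQ hc hdim
  exact ⟨isTopSingComponent_of_height_two 2 R f h0 h1 Q hsing hQ2,
    isPermissibleCentre_two_iff_of_height_two R f h0 h1 Q hsing hQ2 hQm⟩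

end Fork

end Summit.ResolutionOfSingularities.ResolutionOfSingularities.Theorems.SwitchingDichotomy.SigmaTopLegality

end
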